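import Summits.BirchSwinnertonDyer.BirchSwinnertonDyer.Theorems.BiquadraticEisensteinDescentEisensteinHeartFlatCMInertBadKPrimeBiquadraticPrimes
import Literature.NumberTheory.Automorphic.GaloisActionPlaces
import Mathlib.NumberTheory.NumberField.Discriminant.Different
import Literature.NumberTheory.NumberFields.HasseUnitIndexOddDegree
import HarnessLib

set_option linter.dupNamespace false -- `Summit.BirchSwinnertonDyer.BirchSwinnertonDyer.Theorems.…` (summit = sub)
set_option autoImplicit false

/-!
# Crux `EisensteinHeartFlatCMInertBadKPrime` (stmt-BirchSwinnertonDyer-21341), line `hsieh-lambda`, layer 2 —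
# INSTANTIATION tranche 1c: complex conjugation swaps the two primes above `p`; `{𝔓′}` is a `p`-adic CM type

Sequel of `…BiquadraticCMField.lean` / `…BiquadraticPrimes.lean` (same seat, same conventions: THEOREMS ONLY, helper
toward stmt-BirchSwinnertonDyer-21341, nothing about the crux's input or BSD asserted).

## What is proved

In the setting of the two previous files (`K = K′` imaginary quadratic, `[L : K] = 2`, `√d ∈ L` with `d` a
non-square mod `p`, `𝔭 ≠ 𝔭′` the primes of `K` above `p`, `𝔓 ∣ 𝔭`, `𝔓′ ∣ 𝔭′` the primes of `L` above them):

* §4 the complex conjugation of `K` maps `𝔭` into `𝔭′` (`complexConj_smul_mem_of_ne`: `Gal(K/ℚ) = {1, c_K}` is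
  transitive on the primes above `p`, Mathlib `Ideal.exists_smul_eq_of_isGaloisGroup`), hence — `c_L` restricting to
  `c_K` and the prime above `𝔭` being unique — **`c_L · 𝔓′ = 𝔓` and `c_L · 𝔓 = 𝔓′`** (`complexConj_smul_eq`), so
  **`{𝔓′}` and `{𝔓}` are `p`-adic CM types** in the sense of `KatzCM.IsPAdicCMType` (`isPAdicCMType_singleton`) — the
  hypothesis `hSp` (`Σ_p(L) = {𝔓′}`) of `KatzCM.exists_isBaseChangeLine` / `hsieh2014mu_prop49_exists_isMeasure` at the
  route's Katz frame (V2-KATZ-HSIEH memo: `Σ_p(L) = {𝔓′ ∣ 𝔭′}`, `λ = ψ_W∘N_{L/K_CM}·N_L⁻¹`).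
* §4′ `p` is unramified in every subfield `F ⊆ L` (`not_dvd_discr_of_forall_ramificationIdx_eq_one`: descent of
  unramifiedness + Dedekind's discriminant theorem, both Mathlib), in particular **`p ∤ d_{L⁺}`**
  (`not_dvd_discr_maximalRealSubfield`) — the hypothesis `hunr` ((unr) `p ∤ D_F`) of the same existence fact.
* §5 one-call summaries from integer data: `katz_frame_primes` (existence of `𝔓, 𝔓′` with all of the above, the
  `primesOver`/degree bookkeeping and `hunr`) and `isCMField_of_split` (the `[IsCMField L]` instance).

References: [NeukirchANT1999] Ch. I §9 (Galois action on primes); [Hsieh2014mu] §1.1 ((ord), `Σ_p ⊔ Σ_p c`).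
-/

noncomputable section

open scoped Classical NumberField Pointwise
open NumberField IsDedekindDomain Module

namespace Summit.BirchSwinnertonDyer.BirchSwinnertonDyer.Theorems.BiquadraticEisensteinDescentEisensteinHeartFlatCMInertBadKPrimeBiquadraticCMType

open Literature.NumberTheory.EllipticCurves Literature.NumberTheory.NumberFields
open Summit.BirchSwinnertonDyer.BirchSwinnertonDyer.Theorems.BiquadraticEisensteinDescentEisensteinHeartFlatCMInertBadKPrimeBiquadraticCMField
open Summit.BirchSwinnertonDyer.BirchSwinnertonDyer.Theorems.BiquadraticEisensteinDescentEisensteinHeartFlatCMInertBadKPrimeBiquadraticPrimes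

variable {K L : Type} [Field K] [NumberField K] [Field L] [NumberField L] [Algebra K L]

/-! ### §4 Complex conjugation swaps the two primes above `p`; `{𝔓′}` is a `p`-adic CM type -/

section Swap

variable {p : ℕ} [hp : Fact p.Prime]

open Literature.NumberTheory.Automorphic

/-- **In an imaginary quadratic field the complex conjugation swaps the two primes above a split prime**: for
`𝔭 ≠ 𝔭′` above `p`, `c_K(𝔭) ⊆ 𝔭′` elementwise (`Gal(K/ℚ) = {1, c_K}` acts transitively on the primes above `p`).
[cite: NeukirchANT1999, Ch. I §9 (transitivity of the Galois action on primes)] -/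
theorem complexConj_smul_mem_of_ne [IsCMField K] (h2K : finrank ℚ K = 2) {𝔭 𝔭' : HeightOneSpectrum (𝓞 K)}
    (h𝔭 : ((p : ℕ) : 𝓞 K) ∈ 𝔭.asIdeal) (h𝔭' : ((p : ℕ) : 𝓞 K) ∈ 𝔭'.asIdeal) (hne : 𝔭 ≠ 𝔭')
    {k : 𝓞 K} (hk : k ∈ 𝔭.asIdeal) : IsCMField.complexConj K • k ∈ 𝔭'.asIdeal := by
  haveI : Algebra.IsQuadraticExtension ℚ K := { finrank_eq_two' := h2K }
  haveI := 𝔭.isPrime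
  haveI := 𝔭'.isPrime
  haveI := liesOver_span_of_mem h𝔭
  haveI := liesOver_span_of_mem h𝔭'
  -- transitivity of `Gal(K/ℚ)` on the primes above `pℤ`
  obtain ⟨σ, hσ⟩ := Ideal.exists_smul_eq_of_isGaloisGroup (Ideal.span {((p : ℕ) : ℤ)}) 𝔭.asIdeal 𝔭'.asIdeal
    (K ≃ₐ[ℚ] K)
  have hσ1 : σ ≠ 1 := by
    rintro rfl
    rw [one_smul] at hσ
    exact hne (HeightOneSpectrum.ext hσ)
  -- `Gal(K/ℚ) = {1, c_K}`
  set c : K ≃ₐ[ℚ] K := AlgEquiv.ofRingEquiv (f := (IsCMField.complexConj K).toRingEquiv)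
    (fun q ↦ by simp) with hc
  have hc1 : c ≠ 1 := by
    intro h
    apply IsCMField.complexConj_ne_one K
    ext z
    have := AlgEquiv.congr_fun h z
    simpa [hc] using this
  have hcard : Nat.card (K ≃ₐ[ℚ] K) = 2 := by rw [IsGalois.card_aut_eq_finrank, h2K]
  rw [Nat.card_eq_two_iff' (1 : K ≃ₐ[ℚ] K)] at hcard
  have hσc : σ = c := hcard.unique hσ1 hc1
  -- read `σ • k ∈ 𝔭′` for `k ∈ 𝔭`
  have hmem : σ • k ∈ 𝔭'.asIdeal := by rw [← hσ]; exact Ideal.smul_mem_pointwise_smul σ k _ hk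
  have hval : (σ • k : 𝓞 K) = IsCMField.complexConj K • k := by
    apply Subtype.ext
    change σ (k : K) = IsCMField.complexConj K (k : K)
    rw [hσc, hc]
    rfl
  rwa [hval] at hmem

/-- **The complex conjugation of `L` swaps the two primes above `p`**: `c_L · 𝔓′ = 𝔓` (and `c_L · 𝔓 = 𝔓′`), where
`𝔓 ∣ 𝔭`, `𝔓′ ∣ 𝔭′` are the primes of `L = K(√d)` above the two primes `𝔭 ≠ 𝔭′` of the imaginary quadratic `K`
over `p`, `d` a non-square mod `p`: `c_L` restricts to `c_K` on `K`, which swaps `𝔭, 𝔭′`, and the prime above `𝔭`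
is unique. [cite: NeukirchANT1999, Ch. I §9] [cite: Hsieh2014mu, §1.1 (`Σ_p c`)] -/
theorem complexConj_smul_eq [IsCMField K] [IsCMField L] (hK : IsImaginaryQuadratic K) (h2 : finrank K L = 2)
    {d : ℤ} (hd : ¬ IsSquare ((d : ℤ) : ZMod p)) {x : 𝓞 L} (hx : x ^ 2 = (d : 𝓞 L))
    {𝔭 𝔭' : HeightOneSpectrum (𝓞 K)} (h𝔭 : ((p : ℕ) : 𝓞 K) ∈ 𝔭.asIdeal) (h𝔭' : ((p : ℕ) : 𝓞 K) ∈ 𝔭'.asIdeal)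
    (hne : 𝔭 ≠ 𝔭') {𝔓 𝔓' : HeightOneSpectrum (𝓞 L)} [𝔓.asIdeal.LiesOver 𝔭.asIdeal]
    [h' : 𝔓'.asIdeal.LiesOver 𝔭'.asIdeal] :
    IsCMField.complexConj L • 𝔓' = 𝔓 ∧ IsCMField.complexConj L • 𝔓 = 𝔓' := by
  have h4 : finrank ℚ L = 4 := finrank_eq_four hK h2
  set c := IsCMField.complexConj L with hcdef
  -- `c_L • 𝔓′` lies over `𝔭`
  have hover : (c • 𝔓').asIdeal.LiesOver 𝔭.asIdeal := by
    refine ⟨𝔭.isMaximal.eq_of_le (Ideal.IsPrime.under (𝓞 K) (c • 𝔓').asIdeal).ne_top fun k hk ↦ ?_⟩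
    rw [Ideal.mem_comap, HeightOneSpectrum.smul_asIdeal, Ideal.mem_pointwise_smul_iff_inv_smul_mem]
    -- `c⁻¹ • algebraMap k = algebraMap (c_K k) ∈ 𝔓′`
    have hmemK : IsCMField.complexConj K • k ∈ 𝔭'.asIdeal :=
      complexConj_smul_mem_of_ne hK.1 h𝔭 h𝔭' hne hk
    have hmemL : algebraMap (𝓞 K) (𝓞 L) (IsCMField.complexConj K • k) ∈ 𝔓'.asIdeal := by
      have : IsCMField.complexConj K • k ∈ 𝔓'.asIdeal.under (𝓞 K) := by rw [← h'.over]; exact hmemK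
      exact this
    have hinv : c⁻¹ = c := by
      rw [inv_eq_iff_mul_eq_one]
      ext z
      simp [hcdef, AlgEquiv.mul_apply]
    have heq : c⁻¹ • algebraMap (𝓞 K) (𝓞 L) k = algebraMap (𝓞 K) (𝓞 L) (IsCMField.complexConj K • k) := by
      rw [hinv]
      apply Subtype.ext
      change c ((algebraMap (𝓞 K) (𝓞 L) k : 𝓞 L) : L) = ((algebraMap (𝓞 K) (𝓞 L) (IsCMField.complexConj K • k)
        : 𝓞 L) : L)
      rw [Lemmermeyer1995.coe_algebraMap_ringOfIntegers, Lemmermeyer1995.coe_algebraMap_ringOfIntegers, hcdef,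
        complexConj_algebraMap]
      rfl
    rw [heq]
    exact hmemL
  haveI := hover
  have h1 : c • 𝔓' = 𝔓 := liesOver_unique h4 hd hx h𝔭 h𝔭' hne
  refine ⟨h1, ?_⟩
  have hcc : c * c = 1 := by
    ext z
    simp [hcdef, AlgEquiv.mul_apply]
  rw [← h1, smul_smul, hcc, one_smul]

/-- **`Σ_p = {𝔓′}` is a `p`-adic CM type of `L`** (`KatzCM.IsPAdicCMType`): `𝔓′ ∣ p`, and of the two primes
`{𝔓, 𝔓′} = {c 𝔓′, 𝔓′}` above `p` exactly one lies in `Σ_p` — the hypothesis `hSp` of `KatzCM.exists_isBaseChangeLine`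
/ `hsieh2014mu_prop49_exists_isMeasure` at the route's frame (`Σ_p(L) = {𝔓′}`, `𝔓′ ∣ 𝔭′ = c 𝔭`; symmetrically
`{𝔓}`). [cite: Hsieh2014mu, §1.1 ((ord): `Σ_p ⊔ Σ_p c = {w ∣ p}`)] -/
theorem isPAdicCMType_singleton [IsCMField K] [IsCMField L] (hK : IsImaginaryQuadratic K) (h2 : finrank K L = 2)
    {d : ℤ} (hd : ¬ IsSquare ((d : ℤ) : ZMod p)) {x : 𝓞 L} (hx : x ^ 2 = (d : 𝓞 L))
    {𝔭 𝔭' : HeightOneSpectrum (𝓞 K)} (h𝔭 : ((p : ℕ) : 𝓞 K) ∈ 𝔭.asIdeal) (h𝔭' : ((p : ℕ) : 𝓞 K) ∈ 𝔭'.asIdeal)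
    (hne : 𝔭 ≠ 𝔭') {𝔓 𝔓' : HeightOneSpectrum (𝓞 L)} [𝔓.asIdeal.LiesOver 𝔭.asIdeal]
    [𝔓'.asIdeal.LiesOver 𝔭'.asIdeal] :
    KatzCM.IsPAdicCMType p ({𝔓'} : Finset (HeightOneSpectrum (𝓞 L))) ∧
      KatzCM.IsPAdicCMType p ({𝔓} : Finset (HeightOneSpectrum (𝓞 L))) := by
  have h4 : finrank ℚ L = 4 := finrank_eq_four hK h2
  obtain ⟨hswap', hswap⟩ := complexConj_smul_eq hK h2 hd hx h𝔭 h𝔭' hne (𝔓 := 𝔓) (𝔓' := 𝔓')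
  obtain ⟨hpair, hne', -⟩ := primesOver_eq_pair h4 hd hx h𝔭 h𝔭' hne (𝔓 := 𝔓) (𝔓' := 𝔓')
  have hP : ((p : ℕ) : 𝓞 L) ∈ 𝔓.asIdeal := natCast_mem_of_liesOver h𝔭
  have hP' : ((p : ℕ) : 𝓞 L) ∈ 𝔓'.asIdeal := natCast_mem_of_liesOver h𝔭'
  have hall : ∀ w : HeightOneSpectrum (𝓞 L), ((p : ℕ) : 𝓞 L) ∈ w.asIdeal → w = 𝔓 ∨ w = 𝔓' := by
    intro w hw
    have : w ∈ KatzCM.primesOver L p := KatzCM.mem_primesOver.mpr hw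
    rw [hpair, Finset.mem_insert, Finset.mem_singleton] at this
    exact this
  constructor
  · refine ⟨fun w hw ↦ ?_, fun w hw ↦ ?_⟩
    · rw [Finset.mem_singleton] at hw; rw [hw]; exact hP'
    · rw [Finset.mem_singleton, Finset.mem_singleton]
      rcases hall w hw with rfl | rfl
      · rw [hswap]; exact ⟨fun h ↦ absurd h hne', fun h ↦ absurd rfl h⟩
      · rw [hswap']; exact ⟨fun _ ↦ hne', fun _ ↦ rfl⟩
  · refine ⟨fun w hw ↦ ?_, fun w hw ↦ ?_⟩
    · rw [Finset.mem_singleton] at hw; rw [hw]; exact hP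
    · rw [Finset.mem_singleton, Finset.mem_singleton]
      rcases hall w hw with rfl | rfl
      · rw [hswap]; exact ⟨fun _ ↦ fun h ↦ hne' h.symm, fun _ ↦ rfl⟩
      · rw [hswap']; exact ⟨fun h ↦ absurd h.symm hne', fun h ↦ absurd rfl h⟩

end Swap

/-! ### §4′ `p` is unramified in every subfield of `L`; in particular `p ∤ d_{L⁺}` -/

section Unramified

variable {p : ℕ} [hp : Fact p.Prime]

/-- **If every prime of `L` above `p` has ramification index `1`, then `p ∤ disc F` for every subfield `F ⊆ L`**
(unramifiedness descends along `𝓞 F → 𝓞 L`, Mathlib `Algebra.IsUnramifiedAt.of_liesOver`; Dedekind's discriminant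
theorem, Mathlib `NumberField.not_dvd_discr_iff_forall_mem`). [cite: NeukirchANT1999, Ch. III §2 (Thm. 2.6, Cor. 2.12)] -/
theorem not_dvd_discr_of_forall_ramificationIdx_eq_one (F : Type) [Field F] [NumberField F] [Algebra F L]
    (h : ∀ 𝔔 : HeightOneSpectrum (𝓞 L), ((p : ℕ) : 𝓞 L) ∈ 𝔔.asIdeal → 𝔔.asIdeal.ramificationIdx ℤ = 1) :
    ¬ ((p : ℕ) : ℤ) ∣ NumberField.discr F := by
  have hpZ : Prime ((p : ℕ) : ℤ) := Nat.prime_iff_prime_int.mp hp.out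
  rw [NumberField.not_dvd_discr_iff_forall_mem F (𝓞 F) hpZ]
  intro 𝔮 h𝔮 hmem
  have hmem' : ((p : ℕ) : 𝓞 F) ∈ 𝔮 := by rwa [Int.cast_natCast] at hmem
  let 𝔮' : HeightOneSpectrum (𝓞 F) := ⟨𝔮, h𝔮, ne_bot_of_mem hmem'⟩
  obtain ⟨𝔓, h𝔓⟩ := exists_liesOver (K := F) (L := L) 𝔮'
  have hP : ((p : ℕ) : 𝓞 L) ∈ 𝔓.asIdeal := natCast_mem_of_liesOver (𝔭 := 𝔮') hmem'
  haveI := 𝔓.isPrime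
  haveI : Algebra.IsUnramifiedAt ℤ 𝔓.asIdeal := Ideal.ramificationIdx_eq_one_iff.mp (h 𝔓 hP)
  exact Algebra.IsUnramifiedAt.of_liesOver ℤ 𝔮 𝔓.asIdeal

/-- **`p ∤ d_{L⁺}`** (`L⁺ = maximalRealSubfield L`, the real quadratic `ℚ(√(d_CM d_{K′}))` of the route): the hypothesis
`hunr` of `KatzCM.exists_isBaseChangeLine` / `hsieh2014mu_prop49_exists_isMeasure` ((unr) `p ∤ D_F`), from
`e(𝔓|p) = e(𝔓′|p) = 1` (`primes_above_eq_and_degrees`). [cite: Hsieh2014mu, §1.1 ((unr))] [cite: NeukirchANT1999, Ch. III §2] -/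
theorem not_dvd_discr_maximalRealSubfield (h4 : finrank ℚ L = 4) {d : ℤ} (hd : ¬ IsSquare ((d : ℤ) : ZMod p))
    {x : 𝓞 L} (hx : x ^ 2 = (d : 𝓞 L)) {𝔓₁ 𝔓₂ : HeightOneSpectrum (𝓞 L)}
    (h₁ : ((p : ℕ) : 𝓞 L) ∈ 𝔓₁.asIdeal) (h₂ : ((p : ℕ) : 𝓞 L) ∈ 𝔓₂.asIdeal) (hne : 𝔓₁ ≠ 𝔓₂) :
    ¬ ((p : ℕ) : ℤ) ∣ NumberField.discr (maximalRealSubfield L) :=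
  not_dvd_discr_of_forall_ramificationIdx_eq_one (L := L) (maximalRealSubfield L)
    fun 𝔔 hQ ↦ ((primes_above_eq_and_degrees h4 hd hx h₁ h₂ hne).2 𝔔 hQ).1

end Unramified

/-! ### §5 Summaries at the route's hypotheses -/

section Route

variable {p : ℕ} [hp : Fact p.Prime]

open Literature.NumberTheory.Automorphic

/-- **Summary at the route's frame (the Katz side of layer 2).** `K = K′` imaginary quadratic, `[L : K] = 2`,
`x = √d ∈ L` with `d` a non-square mod `p` (`p` inert in `K_CM = ℚ(√d)`: `not_isSquare_of_cmInert`), `𝔭 ≠ 𝔭′` primes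
of `K` above `p` (`p` split in `K′`), and `L` a CM field (`isCMField`). Then there are primes `𝔓 ∣ 𝔭`, `𝔓′ ∣ 𝔭′`
of `L` with: `{w ∣ p} = {𝔓, 𝔓′}` (`KatzCM.primesOver`), `𝔓 ≠ 𝔓′`, both unramified of residue degree `2` over `ℤ`,
`c_L 𝔓′ = 𝔓`, `c_L 𝔓 = 𝔓′`, `{𝔓′}`, `{𝔓}` are `p`-adic CM types (`KatzCM.IsPAdicCMType`), and `p ∤ d_{L⁺}` — the
structural hypotheses `hSp` (`Σ_p(L) = {𝔓′}`), `hunr` of `KatzCM.exists_isBaseChangeLine` /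
`hsieh2014mu_prop49_exists_isMeasure` and the bookkeeping of `primesOver L p` in `…KatzHsiehDisplay.exists_span_C_mul_eq`
(`hramS`).
[cite: Hsieh2014mu, §1.1] [cite: NeukirchANT1999, Ch. I §8–§9] -/
theorem katz_frame_primes [IsCMField K] [IsCMField L] (hK : IsImaginaryQuadratic K) (h2 : finrank K L = 2)
    {d : ℤ} (hd : ¬ IsSquare ((d : ℤ) : ZMod p)) {x : L} (hx : x ^ 2 = (d : L))
    {𝔭 𝔭' : HeightOneSpectrum (𝓞 K)} (h𝔭 : ((p : ℕ) : 𝓞 K) ∈ 𝔭.asIdeal) (h𝔭' : ((p : ℕ) : 𝓞 K) ∈ 𝔭'.asIdeal)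
    (hne : 𝔭 ≠ 𝔭') :
    ∃ 𝔓 𝔓' : HeightOneSpectrum (𝓞 L), 𝔓.asIdeal.LiesOver 𝔭.asIdeal ∧ 𝔓'.asIdeal.LiesOver 𝔭'.asIdeal ∧ 𝔓 ≠ 𝔓' ∧
      KatzCM.primesOver L p = {𝔓, 𝔓'} ∧
      (𝔓.asIdeal.ramificationIdx ℤ = 1 ∧ 𝔓.asIdeal.inertiaDeg ℤ = 2 ∧
        𝔓'.asIdeal.ramificationIdx ℤ = 1 ∧ 𝔓'.asIdeal.inertiaDeg ℤ = 2) ∧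
      IsCMField.complexConj L • 𝔓' = 𝔓 ∧ IsCMField.complexConj L • 𝔓 = 𝔓' ∧
      KatzCM.IsPAdicCMType p ({𝔓'} : Finset (HeightOneSpectrum (𝓞 L))) ∧
      KatzCM.IsPAdicCMType p ({𝔓} : Finset (HeightOneSpectrum (𝓞 L))) ∧
      ¬ ((p : ℕ) : ℤ) ∣ NumberField.discr (maximalRealSubfield L) := by
  have h4 : finrank ℚ L = 4 := finrank_eq_four hK h2
  obtain ⟨y, -, hy⟩ := exists_ringOfIntegers_sq_eq hx
  obtain ⟨𝔓, h𝔓⟩ := exists_liesOver (L := L) 𝔭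
  obtain ⟨𝔓', h𝔓'⟩ := exists_liesOver (L := L) 𝔭'
  obtain ⟨hpair, hne', he, hf, he', hf'⟩ := primesOver_eq_pair h4 hd hy h𝔭 h𝔭' hne (𝔓 := 𝔓) (𝔓' := 𝔓')
  obtain ⟨hs', hs⟩ := complexConj_smul_eq hK h2 hd hy h𝔭 h𝔭' hne (𝔓 := 𝔓) (𝔓' := 𝔓')
  obtain ⟨ht', ht⟩ := isPAdicCMType_singleton hK h2 hd hy h𝔭 h𝔭' hne (𝔓 := 𝔓) (𝔓' := 𝔓')
  have hunr := not_dvd_discr_maximalRealSubfield h4 hd hy (natCast_mem_of_liesOver h𝔭) (natCast_mem_of_liesOver h𝔭') hne'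
  exact ⟨𝔓, 𝔓', h𝔓, h𝔓', hne', hpair, ⟨he, hf, he', hf'⟩, hs', hs, ht', ht, hunr⟩

/-- **The CM-field instance at the route's frame**, from integer data: `[L : K] = 2`, `K` imaginary quadratic,
`x = √d ∈ L`, `d < 0` a non-square mod a prime `p` split in `K` as `𝔭 ≠ 𝔭′`. [cite: NeukirchANT1999, Ch. III §1] -/
theorem isCMField_of_split (hK : IsImaginaryQuadratic K) (h2 : finrank K L = 2) {d : ℤ} (hd0 : d < 0)
    (hd : ¬ IsSquare ((d : ℤ) : ZMod p)) {x : L} (hx : x ^ 2 = (d : L))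
    {𝔭 𝔭' : HeightOneSpectrum (𝓞 K)} (h𝔭 : ((p : ℕ) : 𝓞 K) ∈ 𝔭.asIdeal) (h𝔭' : ((p : ℕ) : 𝓞 K) ∈ 𝔭'.asIdeal)
    (hne : 𝔭 ≠ 𝔭') : IsCMField L := by
  have hx' : x ^ 2 = algebraMap ℚ L (d : ℚ) := by rw [hx, map_intCast]
  exact isCMField hK h2 hx' (by exact_mod_cast hd0)
    (sqrt_not_mem_range (not_exists_sq_eq_of_split hK.1 hd h𝔭 h𝔭' hne) hx)

end Route

end Summit.BirchSwinnertonDyer.BirchSwinnertonDyer.Theorems.BiquadraticEisensteinDescentEisensteinHeartFlatCMInertBadKPrimeBiquadraticCMType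

end
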